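import Mathlib
import HarnessLib
import Summits.ValiantsHypothesis.ValiantsHypothesis.Theorems.MonotoneRestorationOrbitCompressionQPOrbitToNarrowOfDescent
import Summits.ValiantsHypothesis.ValiantsHypothesis.Theorems.MonotoneRestorationOrbitRestorationLinearVolumeQPBlockDescent
import Literature.Computability.AlgebraicComplexity.VNPClosedUnderComposition
import Summits.ValiantsHypothesis.ValiantsHypothesis.Theorems.MonotoneRestorationOrbitRestorationLinearVolumeQPOrbitSpanCharacterisation

/-!
# Route MonotoneRestoration — aside `OrbitCompressionQP` (stmt-ValiantsHypothesis-18332), line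
# `expression_compression`: RESTRICTED FAMILIES — the registered first stub HOLDS (unrepaired) on every
# restricted family, and the line closes the aside on the class `{f↓}` modulo its second stub ALONE

Block descent (`BlockDescent.block_descent_span`, hand `-8-g1`, p829907): an off-diagonal block substitution `φ_n`
(`y_(inl i, inr j) ↦ x_(i,j)`, all other `y ↦ 0`; level `n + n` → level `n`) maps the ONE-SORTED narrow span of width
`w` into the BIPARTITE narrow span of the same width, in every degree.  For a family `f` on the square matrices the
RESTRICTED family is `f↓_n := φ_n (f_{n+n})` (`f_{n+n}` read on an off-diagonal — for matrix-symmetric `f`, on the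
principal — `n × n` block, `BlockDescentRestricted.aeval_block_eq_aeval_principal`).  Route-independent (no
`Theses` import).  Consequences for THIS aside:

* `rename_aeval_block`, `restrict_matrixSymmetric` — `f` matrix-symmetric ⟹ `f↓` matrix-symmetric (the block
  substitution intertwines `(σ, τ)` at level `n` with `(σ ⊕ 1, 1 ⊕ τ)` at level `n + n`);
* `restrict_mem_narrowSpan_of_qpOrbit` — **for EVERY family with square-symmetric circuits of quasi-polynomial
  ORBIT size (no symmetry hypothesis on `f`), `f↓_n` lies in the BIPARTITE narrow span of width
  `(log₂ n + c)^c` on every level** (support theorem in span form `OrbitSupport.diNarrowSpan_of_qpOrbitFamily` at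
  level `n + n`, then block descent);
* ★ `restrict_narrowExpression_of_qpOrbit` — **THE REGISTERED `stub_orbitToNarrowExpression` — FALSE for `f` as
  stated (`…OrbitToNarrowExpressionFalse`, witness: the trace) — HOLDS VERBATIM FOR `f↓`, for every qp-orbit family
  `f`** (K2 `OrbitRestorationQPHomPolyClose.stub_homPoly_close` + linearity; the trace restricts to `0`);
* `restrict_mem_class` — the hypothesis class of the aside (matrix-symmetric, `VP`, qp orbits) is mapped into
  itself by `f ↦ f↓` (the `VP` part repeats the argument of `BlockDescentRestricted.isVPFamily_restrict`, hand
  `-8-g1`, to keep this file route-independent);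
* ★★ `orbitCompression_restrict_of_stub2` — **STUB 2 ALONE ⟹ the conclusion of `OrbitCompressionQP` for every
  restricted family `f↓`, `f` in the aside's hypothesis class** (Stub 2 + THEOREM ζ-P `qpSymmetric_patternExpr`):
  the registered line closes the aside on `{f↓}` with NO descent hypothesis and in EVERY degree — compare the
  half-degree class (`…OrbitToNarrowHalfDegree`, p829729) and the full reduction to qp-descent (`…OfDescent`,
  `…StubOneIffDescent`);
* `orbitCompression_of_selfRestricting_of_stub2` — for SELF-RESTRICTING families (`f_n = φ_n(f_{n+n})`, e.g.
  level-uniform hom-expansions without isolated vertices) Stub 2 gives the aside for `f` itself.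

So the residue of the repaired first stub (= qp-descent, `StubOneIffDescent.stub1_iff_qpDescentAbove`) is, in family
language, LIFTING: which matrix-symmetric qp-orbit families are restrictions `f↓` of qp-orbit families (the same
residue as for the sibling aside R1, `…BlockDescentRestricted` / `…BlockDescentLift`).  Honest label: corollaries
of block descent for the aside; Stub 2, the aside and VP ≠ VNP are NOT moved.  Def-free helper
(`--supports stmt-ValiantsHypothesis-18332`); nothing here is a named fact.

References: Dawar–Pago–Seppelt 2025 (arXiv:2502.06740) Thm 1.1, §5, §7 p. 45; Dwivedi–Pago–Seppelt 2026
(arXiv:2601.09343) eq. (1), Outlook Q3; Bürgisser 2000, Def. 2.1.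
-/

noncomputable section

open scoped Classical

-- `Summit.ValiantsHypothesis.ValiantsHypothesis.…` is the tree's single-conjunct layout (Sub = Summit).
set_option linter.dupNamespace false

namespace Summit.ValiantsHypothesis.ValiantsHypothesis.Theorems

namespace OrbitCompressionRestricted

open Literature.Computability.AlgebraicComplexity MvPolynomial
open Literature.Combinatorics.SimpleGraph (treewidth)
open Summit.ValiantsHypothesis.ValiantsHypothesis.Theorems.OrbitRestorationQPHomPolyClose

/-! ### Matrix symmetry of restricted polynomials -/

/-- **The block substitution intertwines matrix symmetries**: renaming `x_(i,j) ↦ x_(σ i, τ j)` after an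
off-diagonal block substitution is the block substitution after renaming by `(σ ⊕ 1, 1 ⊕ τ)` at level `n + n`;
hence `φ_n(p)` is matrix-symmetric whenever `p` is. [folklore] -/
theorem rename_aeval_block {n : ℕ} (φ : Fin (n + n) × Fin (n + n) → MvPolynomial (Fin n × Fin n) ℂ)
    (hφ : ∀ i j : Fin n, φ (finSumFinEquiv (Sum.inl i), finSumFinEquiv (Sum.inr j)) = X (i, j) ∧
      φ (finSumFinEquiv (Sum.inl i), finSumFinEquiv (Sum.inl j)) = 0 ∧
      φ (finSumFinEquiv (Sum.inr i), finSumFinEquiv (Sum.inl j)) = 0 ∧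
      φ (finSumFinEquiv (Sum.inr i), finSumFinEquiv (Sum.inr j)) = 0)
    (p : MvPolynomial (Fin (n + n) × Fin (n + n)) ℂ)
    (hp : ∀ σ τ : Equiv.Perm (Fin (n + n)),
      rename (fun ij : Fin (n + n) × Fin (n + n) => (σ ij.1, τ ij.2)) p = p)
    (σ τ : Equiv.Perm (Fin n)) :
    rename (fun ij : Fin n × Fin n => (σ ij.1, τ ij.2)) (aeval φ p) = aeval φ p := by
  -- the lifted permutations `σ ⊕ 1` (row block) and `1 ⊕ τ` (column block)
  let σ' : Equiv.Perm (Fin (n + n)) :=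
    finSumFinEquiv.symm.trans ((σ.sumCongr (Equiv.refl (Fin n))).trans finSumFinEquiv)
  let τ' : Equiv.Perm (Fin (n + n)) :=
    finSumFinEquiv.symm.trans (((Equiv.refl (Fin n)).sumCongr τ).trans finSumFinEquiv)
  have hσl : ∀ i, σ' (finSumFinEquiv (Sum.inl i)) = finSumFinEquiv (Sum.inl (σ i)) := fun i => by
    simp only [σ', Equiv.trans_apply, Equiv.symm_apply_apply, Equiv.sumCongr_apply, Sum.map_inl]
  have hσr : ∀ i, σ' (finSumFinEquiv (Sum.inr i)) = finSumFinEquiv (Sum.inr i) := fun i => by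
    simp only [σ', Equiv.trans_apply, Equiv.symm_apply_apply, Equiv.sumCongr_apply, Sum.map_inr,
      Equiv.coe_refl]
    rfl
  have hτl : ∀ j, τ' (finSumFinEquiv (Sum.inl j)) = finSumFinEquiv (Sum.inl j) := fun j => by
    simp only [τ', Equiv.trans_apply, Equiv.symm_apply_apply, Equiv.sumCongr_apply, Sum.map_inl,
      Equiv.coe_refl]
    rfl
  have hτr : ∀ j, τ' (finSumFinEquiv (Sum.inr j)) = finSumFinEquiv (Sum.inr (τ j)) := fun j => by
    simp only [τ', Equiv.trans_apply, Equiv.symm_apply_apply, Equiv.sumCongr_apply, Sum.map_inr]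
  -- entrywise: renaming the substituted entry is substituting the permuted entry
  have key : ∀ y : Fin (n + n) × Fin (n + n),
      rename (fun ij : Fin n × Fin n => (σ ij.1, τ ij.2)) (φ y) = φ (σ' y.1, τ' y.2) := by
    rintro ⟨a, b⟩
    obtain ⟨s, rfl⟩ := finSumFinEquiv.surjective a
    obtain ⟨t, rfl⟩ := finSumFinEquiv.surjective b
    rcases s with i | i <;> rcases t with j | j
    · rw [(hφ i j).2.1, hσl, hτl, (hφ (σ i) j).2.1, map_zero]
    · rw [(hφ i j).1, hσl, hτr, (hφ (σ i) (τ j)).1, rename_X]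
    · rw [(hφ i j).2.2.1, hσr, hτl, (hφ i j).2.2.1, map_zero]
    · rw [(hφ i j).2.2.2, hσr, hτr, (hφ i (τ j)).2.2.2, map_zero]
  have hcomp : (rename (fun ij : Fin n × Fin n => (σ ij.1, τ ij.2))).comp (aeval φ) =
      (aeval φ).comp (rename (fun ij : Fin (n + n) × Fin (n + n) => (σ' ij.1, τ' ij.2))) := by
    refine MvPolynomial.algHom_ext fun y => ?_
    simp only [AlgHom.comp_apply, aeval_X, rename_X, key]
  have h := congrArg (fun g => g p) hcomp
  simp only [AlgHom.comp_apply] at h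
  rw [h, hp σ' τ']

/-- **Restriction preserves matrix symmetry.** [folklore] -/
theorem restrict_matrixSymmetric (φ : (n : ℕ) → Fin (n + n) × Fin (n + n) → MvPolynomial (Fin n × Fin n) ℂ)
    (hφ : ∀ n (i j : Fin n), φ n (finSumFinEquiv (Sum.inl i), finSumFinEquiv (Sum.inr j)) = X (i, j) ∧
      φ n (finSumFinEquiv (Sum.inl i), finSumFinEquiv (Sum.inl j)) = 0 ∧
      φ n (finSumFinEquiv (Sum.inr i), finSumFinEquiv (Sum.inl j)) = 0 ∧
      φ n (finSumFinEquiv (Sum.inr i), finSumFinEquiv (Sum.inr j)) = 0)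
    (f : (n : ℕ) → MvPolynomial (Fin n × Fin n) ℂ)
    (hsymm : ∀ (n : ℕ) (σ τ : Equiv.Perm (Fin n)),
      rename (fun ij : Fin n × Fin n => (σ ij.1, τ ij.2)) (f n) = f n) :
    ∀ (n : ℕ) (σ τ : Equiv.Perm (Fin n)),
      rename (fun ij : Fin n × Fin n => (σ ij.1, τ ij.2)) (aeval (φ n) (f (n + n))) =
        aeval (φ n) (f (n + n)) :=
  fun n σ τ => rename_aeval_block (φ n) (hφ n) (f (n + n)) (hsymm (n + n)) σ τ

/-! ### Restricted families of qp-orbit families are bipartitely narrow -/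

/-- **For every family with square-symmetric circuits of quasi-polynomial orbit size, the restricted family lies
in the BIPARTITE narrow span of width `(log₂ n + c)^c` on every level** (no symmetry hypothesis on `f`, no degree
threshold): the support theorem in span form at level `n + n` (`OrbitSupport.diNarrowSpan_of_qpOrbitFamily`), then
block descent. [cite: DawarPagoSeppelt2025, Theorem 1.1 and §7 (p. 45)] -/
theorem restrict_mem_narrowSpan_of_qpOrbit
    (φ : (n : ℕ) → Fin (n + n) × Fin (n + n) → MvPolynomial (Fin n × Fin n) ℂ)
    (hφ : ∀ n (i j : Fin n), φ n (finSumFinEquiv (Sum.inl i), finSumFinEquiv (Sum.inr j)) = X (i, j) ∧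
      φ n (finSumFinEquiv (Sum.inl i), finSumFinEquiv (Sum.inl j)) = 0 ∧
      φ n (finSumFinEquiv (Sum.inr i), finSumFinEquiv (Sum.inl j)) = 0 ∧
      φ n (finSumFinEquiv (Sum.inr i), finSumFinEquiv (Sum.inr j)) = 0)
    (f : (n : ℕ) → MvPolynomial (Fin n × Fin n) ℂ)
    (horb : ∃ c : ℕ, ∀ n : ℕ, ∃ (G : Type) (_ : Fintype G)
        (C : LabelledArithCircuit ℂ (Fin n × Fin n) Unit G),
      C.IsSymmetric (Equiv.Perm (Fin n)) ∧ C.eval (C.output ()) = f n ∧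
      C.orbitSize (Equiv.Perm (Fin n)) ≤ 2 ^ ((Nat.log 2 n + c) ^ c)) :
    ∃ c : ℕ, ∀ n : ℕ, aeval (φ n) (f (n + n)) ∈ Submodule.span ℂ {q : MvPolynomial (Fin n × Fin n) ℂ |
      ∃ (a b : ℕ) (F : Multiset (Fin a × Fin b)),
        treewidth (SimpleGraph.fromRel fun u v : Fin a ⊕ Fin b =>
            ∃ e ∈ F, u = Sum.inl e.1 ∧ v = Sum.inr e.2) ≤ (Nat.log 2 n + c) ^ c ∧ q = homPoly F n ℂ} := by
  obtain ⟨c, hc⟩ := OrbitSupport.diNarrowSpan_of_qpOrbitFamily f horb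
  -- width bookkeeping `(log₂ (n+n) + c)^c ≤ (log₂ n + (c+1))^(c+1)` (as in `BlockDescentRestricted.width_double_le`)
  have hwidth : ∀ n : ℕ, (Nat.log 2 (n + n) + c) ^ c ≤ (Nat.log 2 n + (c + 1)) ^ (c + 1) := by
    intro n
    have hlog : Nat.log 2 (n + n) ≤ Nat.log 2 n + 1 := by
      rcases Nat.eq_zero_or_pos n with rfl | hn
      · simp
      · rw [← two_mul, mul_comm, Nat.log_mul_base (by norm_num) hn.ne']
    calc (Nat.log 2 (n + n) + c) ^ c ≤ (Nat.log 2 n + (c + 1)) ^ c :=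
          Nat.pow_le_pow_left (by omega) c
      _ ≤ (Nat.log 2 n + (c + 1)) ^ (c + 1) := Nat.pow_le_pow_right (by omega) (by omega)
  refine ⟨c + 1, fun n => OrbitToNarrowOfDescent.narrowSpan_mono n (hwidth n) ?_⟩
  exact BlockDescent.block_descent_span (φ n) (hφ n) _ _ (hc (n + n))

/-- ★ **THE REGISTERED FIRST STUB HOLDS ON EVERY RESTRICTED FAMILY.**  For every family `f` with square-symmetric
circuits of quasi-polynomial ORBIT size — matrix-symmetric or not — the restricted family `f↓` is, for one `c` and
every `n ≥ 1`, the closed polynomial of a bipartite labelled pattern expression with `n^{k+l} ≤ 2^{(log₂ n + c)^c}`: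
verbatim the conclusion of the registered `stub_orbitToNarrowExpression` (which is false for `f` itself without
matrix symmetry, `OrbitToNarrowExpression.not_stub_orbitToNarrowExpression`: the trace; the trace restricts to `0`).
[cite: DawarPagoSeppelt2025, Theorem 1.1 and §7 (p. 45)] -/
theorem restrict_narrowExpression_of_qpOrbit
    (φ : (n : ℕ) → Fin (n + n) × Fin (n + n) → MvPolynomial (Fin n × Fin n) ℂ)
    (hφ : ∀ n (i j : Fin n), φ n (finSumFinEquiv (Sum.inl i), finSumFinEquiv (Sum.inr j)) = X (i, j) ∧
      φ n (finSumFinEquiv (Sum.inl i), finSumFinEquiv (Sum.inl j)) = 0 ∧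
      φ n (finSumFinEquiv (Sum.inr i), finSumFinEquiv (Sum.inl j)) = 0 ∧
      φ n (finSumFinEquiv (Sum.inr i), finSumFinEquiv (Sum.inr j)) = 0)
    (f : (n : ℕ) → MvPolynomial (Fin n × Fin n) ℂ)
    (horb : ∃ c : ℕ, ∀ n : ℕ, ∃ (G : Type) (_ : Fintype G)
        (C : LabelledArithCircuit ℂ (Fin n × Fin n) Unit G),
      C.IsSymmetric (Equiv.Perm (Fin n)) ∧ C.eval (C.output ()) = f n ∧
      C.orbitSize (Equiv.Perm (Fin n)) ≤ 2 ^ ((Nat.log 2 n + c) ^ c)) :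
    ∃ c : ℕ, ∀ n : ℕ, 1 ≤ n → ∃ (k l : ℕ) (e : PatternExpr ℂ k l),
      n ^ (k + l) ≤ 2 ^ ((Nat.log 2 n + c) ^ c) ∧ e.close n = aeval (φ n) (f (n + n)) := by
  obtain ⟨c, hc⟩ := restrict_mem_narrowSpan_of_qpOrbit φ hφ f horb
  refine ⟨c + 5, fun n hn => ?_⟩
  obtain ⟨e, he⟩ := narrowExpression_of_mem_narrowSpan stub_homPoly_close n c hn _ (hc n)
  exact ⟨_, _, e, OrbitRestorationLinearVolumeQPDiNarrow.pow_twice_polylog_le_qp n c, he⟩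

/-- **The hypothesis class of the aside is closed under restriction.**  If `f` is matrix-symmetric, `VP`, and has
square-symmetric circuits of quasi-polynomial orbit size, then so is / does `f↓`: matrix symmetry by
`restrict_matrixSymmetric`; `VP` by reindexing along `n ↦ n + n` and substituting variables/zeros
(`IsVPFamily.reindex`, `IsVPFamily.aeval` — the argument of `BlockDescentRestricted.isVPFamily_restrict`, hand `-8-g1`,
repeated here to stay route-independent); qp orbits because narrow bipartite expressions have qp orbits
(`restrict_narrowExpression_of_qpOrbit`, `NarrowToOrbit.qpOrbit_of_narrowExpression'`).
[cite: DawarPagoSeppelt2025, Theorem 1.1] -/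
theorem restrict_mem_class
    (φ : (n : ℕ) → Fin (n + n) × Fin (n + n) → MvPolynomial (Fin n × Fin n) ℂ)
    (hφ : ∀ n (i j : Fin n), φ n (finSumFinEquiv (Sum.inl i), finSumFinEquiv (Sum.inr j)) = X (i, j) ∧
      φ n (finSumFinEquiv (Sum.inl i), finSumFinEquiv (Sum.inl j)) = 0 ∧
      φ n (finSumFinEquiv (Sum.inr i), finSumFinEquiv (Sum.inl j)) = 0 ∧
      φ n (finSumFinEquiv (Sum.inr i), finSumFinEquiv (Sum.inr j)) = 0)
    (f : (n : ℕ) → MvPolynomial (Fin n × Fin n) ℂ)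
    (hsymm : ∀ (n : ℕ) (σ τ : Equiv.Perm (Fin n)),
      rename (fun ij : Fin n × Fin n => (σ ij.1, τ ij.2)) (f n) = f n)
    (hVP : IsVPFamily f)
    (horb : ∃ c : ℕ, ∀ n : ℕ, ∃ (G : Type) (_ : Fintype G)
        (C : LabelledArithCircuit ℂ (Fin n × Fin n) Unit G),
      C.IsSymmetric (Equiv.Perm (Fin n)) ∧ C.eval (C.output ()) = f n ∧
      C.orbitSize (Equiv.Perm (Fin n)) ≤ 2 ^ ((Nat.log 2 n + c) ^ c)) :
    (∀ (n : ℕ) (σ τ : Equiv.Perm (Fin n)),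
      rename (fun ij : Fin n × Fin n => (σ ij.1, τ ij.2)) (aeval (φ n) (f (n + n))) =
        aeval (φ n) (f (n + n))) ∧
    (IsVPFamily fun n => aeval (φ n) (f (n + n))) ∧
    (∃ c : ℕ, ∀ n : ℕ, ∃ (G : Type) (_ : Fintype G)
        (C : LabelledArithCircuit ℂ (Fin n × Fin n) Unit G),
      C.IsSymmetric (Equiv.Perm (Fin n)) ∧ C.eval (C.output ()) = aeval (φ n) (f (n + n)) ∧
      C.orbitSize (Equiv.Perm (Fin n)) ≤ 2 ^ ((Nat.log 2 n + c) ^ c)) := by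
  refine ⟨restrict_matrixSymmetric φ hφ f hsymm, ?_,
    NarrowToOrbit.qpOrbit_of_narrowExpression' _ (restrict_narrowExpression_of_qpOrbit φ hφ f horb)⟩
  -- every entry of a block substitution is a variable or `0`
  have hentry : ∀ n (ij : Fin (n + n) × Fin (n + n)), φ n ij = 0 ∨ ∃ p : Fin n × Fin n, φ n ij = X p := by
    rintro n ⟨u, v⟩
    obtain ⟨x, rfl⟩ := finSumFinEquiv.surjective u
    obtain ⟨y, rfl⟩ := finSumFinEquiv.surjective v
    rcases x with i | i <;> rcases y with j | j
    · exact Or.inl (hφ n i j).2.1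
    · exact Or.inr ⟨(i, j), (hφ n i j).1⟩
    · exact Or.inl (hφ n i j).2.2.1
    · exact Or.inl (hφ n i j).2.2.2
  have hcx : ∀ n (ij : Fin (n + n) × Fin (n + n)), complexity (φ n ij) = 0 := by
    intro n ij
    rcases hentry n ij with h | ⟨p, h⟩
    · rw [h, ← C_0]; exact complexity_C_holds _
    · rw [h]; exact complexity_X_holds _
  have hdeg : ∀ n (ij : Fin (n + n) × Fin (n + n)), (φ n ij).totalDegree ≤ 1 := by
    intro n ij
    rcases hentry n ij with h | ⟨p, h⟩
    · rw [h, totalDegree_zero]; exact Nat.zero_le _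
    · rw [h, totalDegree_X]
  have ht : IsPBounded fun n => n + n := ⟨2, fun n => by nlinarith⟩
  have h2 := IsVPFamily.reindex hVP ht
  refine IsVPFamily.aeval (ρ := fun n => Fin (n + n) × Fin (n + n)) h2 φ ⟨2, fun n => ?_⟩ ⟨1, fun n => ?_⟩
    ⟨0, fun n => ?_⟩
  · show Fintype.card (Fin n × Fin n) ≤ n ^ 2 + 2
    simp only [Fintype.card_prod, Fintype.card_fin]; nlinarith
  · show (Finset.univ.sup fun ij => (φ n ij).totalDegree) ≤ n ^ 1 + 1
    exact (Finset.sup_le fun ij _ => hdeg n ij).trans (by omega)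
  · show (∑ ij, complexity (φ n ij)) ≤ n ^ 0 + 0
    rw [Finset.sum_eq_zero fun ij _ => hcx n ij]
    exact Nat.zero_le _

/-! ### The line closes the aside on restricted families modulo Stub 2 alone -/

/-- ★★ **STUB 2 ALONE ⟹ `OrbitCompressionQP` ON EVERY RESTRICTED FAMILY.**  Assume the second stub
`stub_narrowExpressionCompression` of line `expression_compression` (verbatim).  Then for every family `f` in the
hypothesis class of the aside — matrix-symmetric, `VP`, square-symmetric circuits of quasi-polynomial ORBIT size —
the restricted family `f↓_n = φ_n(f_{n+n})` has square-symmetric circuits of quasi-polynomial SIZE: `f↓` is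
matrix-symmetric (`restrict_matrixSymmetric`), `VP` (`restrict_mem_class`) and narrowly
expressed (`restrict_narrowExpression_of_qpOrbit` — the first stub, unconditionally), so Stub 2 compresses and
THEOREM ζ-P (`qpSymmetric_patternExpr`) builds the circuits.  No descent hypothesis, every degree.
[cite: DwivediPagoSeppelt2026, Outlook Q3] [cite: DawarPagoSeppelt2025, §5] -/
theorem orbitCompression_restrict_of_stub2
    (stub2 : ∀ f : (n : ℕ) → MvPolynomial (Fin n × Fin n) ℂ,
      (∀ (n : ℕ) (σ τ : Equiv.Perm (Fin n)),
        MvPolynomial.rename (fun p : Fin n × Fin n => (σ p.1, τ p.2)) (f n) = f n) →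
      IsVPFamily f →
      (∃ c : ℕ, ∀ n : ℕ, 1 ≤ n → ∃ (k l : ℕ) (e : PatternExpr ℂ k l),
        n ^ (k + l) ≤ 2 ^ ((Nat.log 2 n + c) ^ c) ∧ e.close n = f n) →
      ∃ c : ℕ, ∀ n : ℕ, 1 ≤ n → ∃ (k l : ℕ) (e : PatternExpr ℂ k l),
        n ^ (k + l) ≤ 2 ^ ((Nat.log 2 n + c) ^ c) ∧ e.length ≤ 2 ^ ((Nat.log 2 n + c) ^ c) ∧
        e.close n = f n)
    (φ : (n : ℕ) → Fin (n + n) × Fin (n + n) → MvPolynomial (Fin n × Fin n) ℂ)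
    (hφ : ∀ n (i j : Fin n), φ n (finSumFinEquiv (Sum.inl i), finSumFinEquiv (Sum.inr j)) = X (i, j) ∧
      φ n (finSumFinEquiv (Sum.inl i), finSumFinEquiv (Sum.inl j)) = 0 ∧
      φ n (finSumFinEquiv (Sum.inr i), finSumFinEquiv (Sum.inl j)) = 0 ∧
      φ n (finSumFinEquiv (Sum.inr i), finSumFinEquiv (Sum.inr j)) = 0)
    (f : (n : ℕ) → MvPolynomial (Fin n × Fin n) ℂ)
    (hsymm : ∀ (n : ℕ) (σ τ : Equiv.Perm (Fin n)),
      rename (fun ij : Fin n × Fin n => (σ ij.1, τ ij.2)) (f n) = f n)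
    (hVP : IsVPFamily f)
    (horb : ∃ c : ℕ, ∀ n : ℕ, ∃ (G : Type) (_ : Fintype G)
        (C : LabelledArithCircuit ℂ (Fin n × Fin n) Unit G),
      C.IsSymmetric (Equiv.Perm (Fin n)) ∧ C.eval (C.output ()) = f n ∧
      C.orbitSize (Equiv.Perm (Fin n)) ≤ 2 ^ ((Nat.log 2 n + c) ^ c)) :
    ∃ c : ℕ, ∀ n : ℕ, ∃ (G : Type) (_ : Fintype G)
      (C : LabelledArithCircuit ℂ (Fin n × Fin n) Unit G),
      C.IsSymmetric (Equiv.Perm (Fin n)) ∧ C.eval (C.output ()) = aeval (φ n) (f (n + n)) ∧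
      Fintype.card G ≤ 2 ^ ((Nat.log 2 n + c) ^ c) :=
  qpSymmetric_patternExpr _ (stub2 _ (restrict_matrixSymmetric φ hφ f hsymm)
    (restrict_mem_class φ hφ f hsymm hVP horb).2.1 (restrict_narrowExpression_of_qpOrbit φ hφ f horb))

/-- **SELF-RESTRICTING families: Stub 2 gives the aside for `f` itself.**  If a family in the aside's hypothesis
class satisfies `φ_n(f_{n+n}) = f_n` for all `n` (e.g. level-uniform hom-expansion data without isolated vertices,
`BlockDescent.aeval_block_homPoly_of_noIsolated`), then Stub 2 alone yields square-symmetric circuits of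
quasi-polynomial SIZE for `f`. [cite: DwivediPagoSeppelt2026, Outlook Q3] -/
theorem orbitCompression_of_selfRestricting_of_stub2
    (stub2 : ∀ f : (n : ℕ) → MvPolynomial (Fin n × Fin n) ℂ,
      (∀ (n : ℕ) (σ τ : Equiv.Perm (Fin n)),
        MvPolynomial.rename (fun p : Fin n × Fin n => (σ p.1, τ p.2)) (f n) = f n) →
      IsVPFamily f →
      (∃ c : ℕ, ∀ n : ℕ, 1 ≤ n → ∃ (k l : ℕ) (e : PatternExpr ℂ k l),
        n ^ (k + l) ≤ 2 ^ ((Nat.log 2 n + c) ^ c) ∧ e.close n = f n) →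
      ∃ c : ℕ, ∀ n : ℕ, 1 ≤ n → ∃ (k l : ℕ) (e : PatternExpr ℂ k l),
        n ^ (k + l) ≤ 2 ^ ((Nat.log 2 n + c) ^ c) ∧ e.length ≤ 2 ^ ((Nat.log 2 n + c) ^ c) ∧
        e.close n = f n)
    (φ : (n : ℕ) → Fin (n + n) × Fin (n + n) → MvPolynomial (Fin n × Fin n) ℂ)
    (hφ : ∀ n (i j : Fin n), φ n (finSumFinEquiv (Sum.inl i), finSumFinEquiv (Sum.inr j)) = X (i, j) ∧
      φ n (finSumFinEquiv (Sum.inl i), finSumFinEquiv (Sum.inl j)) = 0 ∧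
      φ n (finSumFinEquiv (Sum.inr i), finSumFinEquiv (Sum.inl j)) = 0 ∧
      φ n (finSumFinEquiv (Sum.inr i), finSumFinEquiv (Sum.inr j)) = 0)
    (f : (n : ℕ) → MvPolynomial (Fin n × Fin n) ℂ)
    (hself : ∀ n, aeval (φ n) (f (n + n)) = f n)
    (hsymm : ∀ (n : ℕ) (σ τ : Equiv.Perm (Fin n)),
      rename (fun ij : Fin n × Fin n => (σ ij.1, τ ij.2)) (f n) = f n)
    (hVP : IsVPFamily f)
    (horb : ∃ c : ℕ, ∀ n : ℕ, ∃ (G : Type) (_ : Fintype G)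
        (C : LabelledArithCircuit ℂ (Fin n × Fin n) Unit G),
      C.IsSymmetric (Equiv.Perm (Fin n)) ∧ C.eval (C.output ()) = f n ∧
      C.orbitSize (Equiv.Perm (Fin n)) ≤ 2 ^ ((Nat.log 2 n + c) ^ c)) :
    ∃ c : ℕ, ∀ n : ℕ, ∃ (G : Type) (_ : Fintype G)
      (C : LabelledArithCircuit ℂ (Fin n × Fin n) Unit G),
      C.IsSymmetric (Equiv.Perm (Fin n)) ∧ C.eval (C.output ()) = f n ∧
      Fintype.card G ≤ 2 ^ ((Nat.log 2 n + c) ^ c) := by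
  obtain ⟨c, hc⟩ := orbitCompression_restrict_of_stub2 stub2 φ hφ f hsymm hVP horb
  refine ⟨c, fun n => ?_⟩
  obtain ⟨G, inst, C, hC, hev, hcard⟩ := hc n
  exact ⟨G, inst, C, hC, hev.trans (hself n), hcard⟩

/-- **The unrepaired first stub restricted: for SELF-RESTRICTING qp-orbit families the registered
`stub_orbitToNarrowExpression` holds outright** (so every counterexample to the registered stub, like the trace,
is a family that is not its own restriction). [cite: DawarPagoSeppelt2025, Theorem 1.1] -/
theorem narrowExpression_of_selfRestricting
    (φ : (n : ℕ) → Fin (n + n) × Fin (n + n) → MvPolynomial (Fin n × Fin n) ℂ)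
    (hφ : ∀ n (i j : Fin n), φ n (finSumFinEquiv (Sum.inl i), finSumFinEquiv (Sum.inr j)) = X (i, j) ∧
      φ n (finSumFinEquiv (Sum.inl i), finSumFinEquiv (Sum.inl j)) = 0 ∧
      φ n (finSumFinEquiv (Sum.inr i), finSumFinEquiv (Sum.inl j)) = 0 ∧
      φ n (finSumFinEquiv (Sum.inr i), finSumFinEquiv (Sum.inr j)) = 0)
    (f : (n : ℕ) → MvPolynomial (Fin n × Fin n) ℂ)
    (hself : ∀ n, aeval (φ n) (f (n + n)) = f n)
    (horb : ∃ c : ℕ, ∀ n : ℕ, ∃ (G : Type) (_ : Fintype G)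
        (C : LabelledArithCircuit ℂ (Fin n × Fin n) Unit G),
      C.IsSymmetric (Equiv.Perm (Fin n)) ∧ C.eval (C.output ()) = f n ∧
      C.orbitSize (Equiv.Perm (Fin n)) ≤ 2 ^ ((Nat.log 2 n + c) ^ c)) :
    ∃ c : ℕ, ∀ n : ℕ, 1 ≤ n → ∃ (k l : ℕ) (e : PatternExpr ℂ k l),
      n ^ (k + l) ≤ 2 ^ ((Nat.log 2 n + c) ^ c) ∧ e.close n = f n := by
  obtain ⟨c, hc⟩ := restrict_narrowExpression_of_qpOrbit φ hφ f horb
  refine ⟨c, fun n hn => ?_⟩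
  obtain ⟨k, l, e, hk, he⟩ := hc n hn
  exact ⟨k, l, e, hk, he.trans (hself n)⟩

end OrbitCompressionRestricted

end Summit.ValiantsHypothesis.ValiantsHypothesis.Theorems

end
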